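import Literature.AnabelianGeometry.EtaleTheta.GalSectMuTwoTransport
import Literature.GroupTheory.ProfiniteCompletionTorsion
import Literature.NumberTheory.GaloisRepresentations.LocalGlobalCohomologyFiniteProofs
import Literature.NumberTheory.GaloisRepresentations.LocalFieldPadicProofs
import HarnessLib

/-!
# `(K^×)^∧[n] = μ_n(K)`: the torsion of the profinite completion of `K^×` for the base field of a tempered
# curve — the (μtor) input of [EtTh] Thm. 1.10 (iii) PROVED (proof-only)

Mochizuki, *The étale theta function …* [EtTh], Publ. RIMS **45** (2009), Thm. 1.10 (iii) p. 256
[cite: MochizukiEtTh2009, Thm 1.10 (iii) p.30]; [GalSect] §4 p. 33 («`H¹(G_K, Ẑ(1)) ≅ (K^×)^∧`, the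
profinite completion of `K^×`») [cite: MochizukiGalSect2005, §4 p.33].  abc-iut cell, layer L2, seat
abc-iut-w5-d062 (gen 4); node EtTh:Thm1.10(iii), residual input (μtor) of the closers
`thm110iiiGalSect_of_Xlevel_twoTorsion` (p443938) / `thm110iiiGalSect_of_Xlevel_v2` (p447025):

  `htor : ∀ x : GalSect.KxHat X, x * x = 1 → x ∈ M.muTwoHat`   («`(K^×)^∧[2] = μ₂(K)`»).

Here `K = X.K` is a GENUINE finite extension of `ℚ_p` inside `ℚ̄_p` (field of `TemperedCurve`), `KxHat X`
is Mathlib's profinite completion of `Kˣ` and `muTwoHat = μ₂(K)·` its image (`GalSectCuspidalTorsors`,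
`GalSectThm110iii`).  PROOF: (1) `[Kˣ : Kˣⁿ] < ∞` for `n ≠ 0` — the tree's
`finite_quotient_range_powMonoidHom_units` (Serre, *Cohomologie galoisienne* II §5.1 (a)) for the
non-archimedean local field structure of a finite extension of `ℚ_p` (`Padic.isNonarchimedeanLocalField_holds`,
`FiniteExtension.isNonarchimedeanLocalField`); (2) `Kˣ[n] = μ_n(K)` is finite (Mathlib `rootsOfUnity`);
(3) the generic lemma `ProfiniteCompletionTorsion.exists_eta_eq_of_pow_eq_one` (torsion of `Â` comes from
`A[n]` when `[A : Aⁿ] < ∞` and `A[n]` is finite).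

* `GalSect.finiteIndex_range_powMonoidHom_units_padic` — `[Kˣ : Kˣⁿ] < ∞` for ANY finite extension `K/ℚ_p`;
* `GalSect.mem_map_rootsOfUnityK_of_pow_eq_one` — `x ∈ (K^×)^∧`, `xⁿ = 1`, `n ≠ 0` ⇒ `x ∈ μ_n(K)`;
* `GalSect.exists_toKxHat_eq_of_pow_eq_one` — … hence `x = toKxHat u` with `uⁿ = 1`;
* `MuTwoSetting.mem_muTwoHat_of_mul_self_eq_one` — THE (μtor) binder, for every `MuTwoSetting p`;
  `MuTwoSetting.mem_muTwoHat_iff_mul_self_eq_one`; `MuTwoSetting.htor` (the binder in its literal shape).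

Theorems only (no definitions, no named facts, no `sorry`).  HONEST FRAMING: classical (profinite groups +
local fields); typed ≠ proved for the node's other inputs; nothing here takes a side on [IUTchIII] Cor. 3.12.
-/

noncomputable section

namespace Literature.AnabelianGeometry.EtaleTheta

open Literature.AnabelianGeometry.SemiGraphs
open Literature.NumberTheory.GaloisRepresentations
open Literature.GroupTheory
open ProfiniteGrp ProfiniteGrp.ProfiniteCompletion

variable {p : ℕ} [Fact p.Prime]

namespace GalSect

/-- **`[Kˣ : Kˣⁿ] < ∞` for a finite extension `K` of `ℚ_p`** (`n ≠ 0`): Serre, *Cohomologie galoisienne*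
II §5.1 (a) — the tree's `finite_quotient_range_powMonoidHom_units` at the non-archimedean local field
structure of `K ⊇ ℚ_p` (`Padic.isNonarchimedeanLocalField_holds`, `FiniteExtension.isNonarchimedeanLocalField`;
the conclusion is topology-free). [cite: SerreGaloisCohomology1997, II §5.1 (a)] -/
theorem finiteIndex_range_powMonoidHom_units_padic (K : Type*) [Field K] [Algebra ℚ_[p] K]
    [FiniteDimensional ℚ_[p] K] (n : ℕ) (hn : n ≠ 0) :
    ((powMonoidHom n : Kˣ →* Kˣ).range).FiniteIndex := by
  haveI : IsNonarchimedeanLocalField ℚ_[p] := Padic.isNonarchimedeanLocalField_holds p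
  letI := FiniteExtension.valuativeRel ℚ_[p] K
  letI := FiniteExtension.topologicalSpace ℚ_[p] K
  haveI : IsNonarchimedeanLocalField K := FiniteExtension.isNonarchimedeanLocalField ℚ_[p] K
  haveI : CharZero K := charZero_of_injective_algebraMap (algebraMap ℚ_[p] K).injective
  letI : UniformSpace K := IsTopologicalAddGroup.rightUniformSpace K
  haveI : IsUniformAddGroup K := isUniformAddGroup_of_addCommGroup
  haveI := finite_quotient_range_powMonoidHom_units K n (Nat.cast_ne_zero.2 hn)
  exact Subgroup.finiteIndex_of_finite_quotient

/-- `Kˣ[n] = μ_n(K)` is finite for a field `K` and `n ≠ 0` (Mathlib `rootsOfUnity`). [cite: MochizukiGalSect2005, §4 p.33] -/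
theorem finite_setOf_pow_eq_one (K : Type*) [Field K] (n : ℕ) (hn : n ≠ 0) :
    {a : Kˣ | a ^ n = 1}.Finite := by
  haveI : NeZero n := ⟨hn⟩
  exact (Set.finite_range fun z : rootsOfUnity n K => (z : Kˣ)).subset fun a ha =>
    ⟨⟨a, (mem_rootsOfUnity n a).mpr ha⟩, rfl⟩

/-- **`(K^×)^∧[n] = μ_n(K)`** for the base field `K` of a tempered curve: an element of the profinite
completion `(K^×)^∧` killed by `n ≠ 0` lies in (the image of) `μ_n(K)`.
[cite: MochizukiGalSect2005, §4 p.33] -/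
theorem mem_map_rootsOfUnityK_of_pow_eq_one (X : TemperedCurve p) {n : ℕ} (hn : n ≠ 0)
    (x : KxHat X) (hx : x ^ n = 1) : x ∈ (rootsOfUnityK X n).map (toKxHat X) := by
  haveI : FiniteDimensional ℚ_[p] ↥X.K := X.finiteDimensional_K
  exact ProfiniteCompletionTorsion.mem_map_eta_of_pow_eq_one
    (finiteIndex_range_powMonoidHom_units_padic (p := p) ↥X.K n hn) (finite_setOf_pow_eq_one ↥X.K n hn)
    (rootsOfUnityK X n) (fun _ ha => ha) x hx

/-- … equivalently `x = toKxHat u` for some `u ∈ K^×` with `uⁿ = 1`. [cite: MochizukiGalSect2005, §4 p.33] -/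
theorem exists_toKxHat_eq_of_pow_eq_one (X : TemperedCurve p) {n : ℕ} (hn : n ≠ 0)
    (x : KxHat X) (hx : x ^ n = 1) : ∃ u : (↥X.K)ˣ, u ^ n = 1 ∧ toKxHat X u = x := by
  obtain ⟨u, hu, hux⟩ := mem_map_rootsOfUnityK_of_pow_eq_one X hn x hx
  exact ⟨u, hu, hux⟩

/-- The case `n = 2` in the binder shape `x * x = 1`: `(K^×)^∧[2] ⊆ μ₂(K)`. [cite: MochizukiGalSect2005, §4 p.33] -/
theorem mem_map_rootsOfUnityK_two_of_mul_self_eq_one (X : TemperedCurve p) (x : KxHat X)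
    (hx : x * x = 1) : x ∈ (rootsOfUnityK X 2).map (toKxHat X) :=
  mem_map_rootsOfUnityK_of_pow_eq_one X two_ne_zero x (by rw [pow_two]; exact hx)

/-- `μ₂(K) = {±1}` in `K^×` (a field): `u ^ 2 = 1 ↔ u = 1 ∨ u = -1`. [cite: MochizukiGalSect2005, §4 p.33] -/
theorem mem_rootsOfUnityK_two_iff (X : TemperedCurve p) (u : (↥X.K)ˣ) :
    u ∈ rootsOfUnityK X 2 ↔ u = 1 ∨ u = -1 := by
  change u ^ 2 = 1 ↔ _
  constructor
  · intro hu
    have h : (u : ↥X.K) * u = 1 := by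
      rw [← Units.val_mul, ← pow_two, hu, Units.val_one]
    rcases mul_self_eq_one_iff.mp h with h1 | h1
    · exact Or.inl (Units.ext h1)
    · exact Or.inr (Units.ext (by rw [Units.val_neg, Units.val_one]; exact h1))
  · rintro (rfl | rfl)
    · exact one_pow 2
    · exact neg_one_sq

end GalSect

namespace MuTwoSetting

/-- **(μtor) PROVED**: for every `MuTwoSetting` (`K = K̈` a finite extension of `ℚ_p`), the `2`-torsion of
`(K^×)^∧` is `μ₂(K)` — `x * x = 1 ⇒ x ∈ muTwoHat`. [cite: MochizukiEtTh2009, Thm 1.10 (iii) p.30] -/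
theorem mem_muTwoHat_of_mul_self_eq_one (M : MuTwoSetting p)
    (x : GalSect.KxHat M.toThetaSetting.toTemperedCurve) (hx : x * x = 1) : x ∈ M.muTwoHat :=
  GalSect.mem_map_rootsOfUnityK_two_of_mul_self_eq_one _ x hx

/-- `x ∈ μ₂(K) ⊆ (K^×)^∧ ↔ x * x = 1` (with `muTwoHat_le_twoTorsion`, p443749).
[cite: MochizukiEtTh2009, Thm 1.10 (iii) p.30] -/
theorem mem_muTwoHat_iff_mul_self_eq_one (M : MuTwoSetting p)
    (x : GalSect.KxHat M.toThetaSetting.toTemperedCurve) : x ∈ M.muTwoHat ↔ x * x = 1 :=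
  ⟨fun hx => M.muTwoHat_le_twoTorsion hx, fun hx => M.mem_muTwoHat_of_mul_self_eq_one x hx⟩

/-- The (μtor) binder of `thm110iiiGalSect_of_Xlevel_twoTorsion` / `_v2` in its LITERAL shape, discharged.
[cite: MochizukiEtTh2009, Thm 1.10 (iii) p.30] -/
theorem htor (M : MuTwoSetting p) :
    ∀ x : GalSect.KxHat M.toThetaSetting.toTemperedCurve, x * x = 1 → x ∈ M.muTwoHat :=
  fun x hx => M.mem_muTwoHat_of_mul_self_eq_one x hx

/-- `μ₂(K)` is exactly `{1, toKxHat (-1)}` read in `(K^×)^∧`: every `2`-torsion element of `(K^×)^∧` is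
`1` or the image of `-1`. [cite: MochizukiEtTh2009, Thm 1.10 (iii) p.30] -/
theorem eq_one_or_eq_toKxHat_neg_one_of_mul_self_eq_one (M : MuTwoSetting p)
    (x : GalSect.KxHat M.toThetaSetting.toTemperedCurve) (hx : x * x = 1) :
    x = 1 ∨ x = GalSect.toKxHat M.toThetaSetting.toTemperedCurve (-1) := by
  obtain ⟨u, hu, rfl⟩ := M.mem_muTwoHat_of_mul_self_eq_one x hx
  rcases (GalSect.mem_rootsOfUnityK_two_iff _ u).mp hu with rfl | rfl
  · exact Or.inl (map_one _)
  · exact Or.inr rfl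

end MuTwoSetting

end Literature.AnabelianGeometry.EtaleTheta

end
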